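import Literature.NumberTheory.ComplexMultiplication.CMAlgebraLatticeClassesClassGroup
import Literature.NumberTheory.ComplexMultiplication.CMAlgebraLatticeSemigroup
import Literature.NumberTheory.ComplexMultiplication.CMAlgebraTorusTypeOfIsogenyClass
import HarnessLib

/-!
# A full `ℤ`-lattice of a CM-ALGEBRA `Y = L_1 ⊕ ⋯ ⊕ L_t` is SANDWICHED between a product of fractional ideals and an
# integer multiple of it; hence every torus with multiplication by `Y` is `Y`-isogenous to the maximal-order product
# `∏ᵢ ℂ^{Φᵢ}/u(𝒪_{Lᵢ})` (Shimura 1998 §6.1 Cor. of Thm. 2 + Remark, §18.7–18.8; Hertling–Larabi 2026 §6 Thm. 6.1, Cor. 6.2)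

Topic `Literature/NumberTheory/ComplexMultiplication`, namespace `Literature.NumberTheory.ComplexMultiplication`.
THEOREMS ONLY (no definition, no named fact, no instance, no `sorry`); everything is an assembly BY NAME of the tree's lattice
library for `Y = Πᵢ Lᵢ` (`CMAlgebraLatticeClassesFinite`: `isFullLattice_piIntegralSubmodule`, `one/mul/single_mem_piIntegralSubmodule`,
`eq_pi_map_proj_of_forall_mul_single_mem`, `isFullLattice_map_proj`; `CMAlgebraLatticeSemigroup`: `isFullLattice_mul`;
`Automorphic/JordanZassenhaus`: `exists_smul_mem_of_fg`) and of its CM-algebra torus library (`CMAlgebraTorusTypeOfIsogenyClass`: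
`IsCMAlgTorusRat.exists_isIsogeny_sigmaPi_equivariant`; `CMAlgebraTorusProduct`: the product torus with its diagonal action
`CMTypeLattice.piLeftMulMatrix`).  The one step that was only PRIVATE in the tree (`CMAlgebraLatticeClassesClassGroup` §1) is made
public here: a full `𝒪_K`-stable `ℤ`-lattice of a number field `K` IS a non-zero fractional ideal of `𝓞 K`.

* §1 `exists_fractionalIdeal_restrictScalars_eq_of_isFullLattice` — full + `𝒪_K`-stable ⟹ `= I` for a fractional ideal `I ≠ 0`
  («`𝒪(L) = Λ_max(A)` … `L` is invertible», [HertlingLarabi2026] Thm. 6.1 (a)(b); [NeukirchANT1999] I §3: the fractional ideals are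
  the finitely generated non-zero `𝒪_K`-submodules of `K`).
* §2 for a full `ℤ`-lattice `Λ ⊂ Y` and the maximal order `𝒪 = ⊕ᵢ 𝒪_{Lᵢ}` (spelled, as in the tree, `Submodule.pi univ (fun i =>
  (integralClosure ℤ (L i)).toSubmodule)`): `Λ ≤ 𝒪·Λ` (`le_piIntegral_mul`), `𝒪·Λ` is a full lattice, `∃ N ≠ 0, N·(𝒪·Λ) ⊆ Λ`
  (`exists_smul_mem_of_mem_piIntegral_mul`), `𝒪·Λ` is `𝒪`-stable and the product of its components (`piIntegral_mul_eq_pi_map_proj`),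
  each component a non-zero fractional ideal; packaged as **`exists_fractionalIdeal_sandwich`**: `∃ (𝔞ᵢ) (N ≠ 0), 𝔞ᵢ ≠ 0 ∧
  Λ ⊆ ⊕ᵢ 𝔞ᵢ ∧ N·(⊕ᵢ 𝔞ᵢ) ⊆ Λ` — Shimura's «`D(𝔪)` and `D(𝔪′)` are commensurable» (§6.2 p. 42) made explicit with `𝔪′ = 𝒪𝔪` a
  product of ideals (§18.8 «It is sufficient to prove the case `𝔞 = 𝔟_1 ⊕ ⋯ ⊕ 𝔟_t`»).
* §3 **`IsCMAlgTorusRat.exists_isIsogeny_sigmaPi_integralBasis_equivariant`** — every complex torus with multiplication by `Y` of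
  full degree (`IsCMAlgTorusRat P ρ`, arbitrary lattice / order) receives a `Y`-EQUIVARIANT isogeny from the maximal-order product
  `∏ᵢ ℂ^{Φᵢ}/u(𝒪_{Lᵢ})` (`Φᵢ` its CM types; Mathlib's `NumberField.integralBasis`): the tree's `exists_isIsogeny_sigmaPi_equivariant`
  ([Shimura1998] §6.1 Cor. + Remark, §18.7–18.8) at `μᵢ := integralBasis (Lᵢ)`.

Use (cell `hodgecm-mathlib`, #60 road, R60-40 / R60-40a; the lattice half of the «order reach» R60-37): banked generic leaf,
books 0.  HC_CM is proved only modulo the 7 printed citations until rung 0 closes.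

## References
* [Shimura1998] G. Shimura, *Abelian Varieties with Complex Multiplication and Modular Functions* (1998), §6.1 Cor. of Thm. 2 and
  Remark (p. 41), §6.2 p. 42 («commensurable»), §7.4 Prop. 17 (p. 58), §18.7–18.8 (pp. 129–130).
* [HertlingLarabi2026] C. Hertling, K. Larabi, arXiv:2602.14973 (2026), §6 Thm. 6.1, Cor. 6.2 (chunk p0015).
* [NeukirchANT1999] J. Neukirch, *Algebraic Number Theory* (1999), Ch. I §3 (fractional ideals), §6.
-/

set_option autoImplicit false

noncomputable section

open scoped Classical Pointwise nonZeroDivisors NumberField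
open Module NumberField Function FractionalIdeal

namespace Literature.NumberTheory.ComplexMultiplication

open Literature.NumberTheory.Automorphic
open Literature.AlgebraicGeometry.Motives (CMType)
open Literature.AlgebraicGeometry.ComplexMultiplication (CMTorus.periodEquiv)
open Literature.Geometry.Kaehler
open Literature.Geometry.Kaehler.ComplexTorus

/-! ## §1 One number field: a full `𝒪_K`-stable lattice is a non-zero fractional ideal -/

section OneField

variable {K : Type} [Field K] [NumberField K]

/-- **A full `𝒪_K`-stable `ℤ`-lattice `M ⊂ K` is a non-zero fractional ideal of `𝓞 K`** (as an `𝓞_K`-module it is `M` itself; a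
common denominator exists because `M` is finitely generated; it is non-zero because it contains a non-zero multiple of `1`).
[cite: HertlingLarabi2026, §6 Thm. 6.1 (a)(b), chunk p0015] [cite: NeukirchANT1999, Ch. I §3 (fractional ideals = finitely generated non-zero 𝒪_K-submodules of K)] -/
theorem exists_fractionalIdeal_restrictScalars_eq_of_isFullLattice {M : Submodule ℤ K} (hM : IsFullLattice K M)
    (hst : ∀ m ∈ M, ∀ a ∈ Subalgebra.toSubmodule (integralClosure ℤ K), m * a ∈ M) :
    ∃ I : FractionalIdeal (𝓞 K)⁰ K, I ≠ 0 ∧ (I : Submodule (𝓞 K) K).restrictScalars ℤ = M := by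
  -- `M` as an `𝓞_K`-submodule
  let J : Submodule (𝓞 K) K :=
    { carrier := M
      add_mem' := fun ha hb => M.add_mem ha hb
      zero_mem' := M.zero_mem
      smul_mem' := fun c x hx => by
        change c • x ∈ M
        rw [Algebra.smul_def, mul_comm]
        exact hst x hx _ ((mem_toSubmodule_integralClosure_iff K).2 (RingOfIntegers.isIntegral_coe c)) }
  -- a common denominator `n`: `nM ⊆ 𝒪_K`
  obtain ⟨n, hn, hnM⟩ := exists_smul_mem_of_fg (isFullLattice_toSubmodule_integralClosure K) hM.1
  have hn' : ((n : 𝓞 K) : 𝓞 K) ∈ (𝓞 K)⁰ := mem_nonZeroDivisors_of_ne_zero (Int.cast_ne_zero.2 hn)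
  have hJ : IsFractional (𝓞 K)⁰ J := by
    refine ⟨(n : 𝓞 K), hn', fun b hb => ?_⟩
    have hb' : b ∈ M := hb
    have hnb := hnM b hb'
    rw [mem_toSubmodule_integralClosure_iff] at hnb
    refine ⟨⟨n • b, (mem_integralClosure_iff ℤ K).2 hnb⟩, ?_⟩
    change n • b = ((n : 𝓞 K) : 𝓞 K) • b
    rw [Algebra.smul_def ((n : 𝓞 K) : 𝓞 K), map_intCast, zsmul_eq_mul]
  refine ⟨⟨J, hJ⟩, fun h0 => ?_, ?_⟩
  · -- `M ≠ 0`: it contains `k·1 ≠ 0`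
    obtain ⟨k, hk, hk1⟩ := hM.2 1
    have hbot : ((J : Submodule (𝓞 K) K) : Set K) = ((⊥ : Submodule (𝓞 K) K) : Set K) := by
      have h1 := congrArg (fun I : FractionalIdeal (𝓞 K)⁰ K => ((I : Submodule (𝓞 K) K) : Set K)) h0
      simpa only [FractionalIdeal.coe_mk, FractionalIdeal.coe_zero] using h1
    have hk1' : (k : ℤ) • (1 : K) ∈ ((J : Submodule (𝓞 K) K) : Set K) := hk1
    rw [hbot] at hk1'
    have h2 : (k : ℤ) • (1 : K) = 0 := (Submodule.mem_bot (𝓞 K)).1 hk1'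
    exact hk (by rwa [zsmul_eq_mul, mul_one, Int.cast_eq_zero] at h2)
  · ext x
    rfl

end OneField

/-! ## §2 The sandwich `Λ ⊆ 𝒪·Λ = ⊕ᵢ 𝔞ᵢ`, `N·(𝒪·Λ) ⊆ Λ` for a full lattice of `Y = ∏ᵢ Lᵢ` -/

section Product

variable {t : Type} {L : t → Type} [∀ i, Field (L i)] [∀ i, NumberField (L i)] [Fintype t] [DecidableEq t]

omit [∀ i, NumberField (L i)] [Fintype t] [DecidableEq t] in
/-- `Λ ⊆ 𝒪·Λ` (`1 ∈ 𝒪 = ⊕ᵢ 𝒪_{Lᵢ}`). [cite: HertlingLarabi2026, §1 («`1_A ∈ Λ`», «`Λ·L = L`»), chunk p0003] -/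
theorem le_piIntegral_mul (Λ : Submodule ℤ (Π i, L i)) :
    Λ ≤ Submodule.pi Set.univ (fun i => Subalgebra.toSubmodule (integralClosure ℤ (L i))) * Λ := fun x hx => by
  simpa only [one_mul] using Submodule.mul_mem_mul one_mem_piIntegralSubmodule hx

omit [DecidableEq t] in
/-- `𝒪·Λ` is a full lattice (products of full lattices are full). [cite: HertlingLarabi2026, §5 Lemma 5.2, chunk p0012] -/
theorem isFullLattice_piIntegral_mul {Λ : Submodule ℤ (Π i, L i)} (hΛ : IsFullLattice (Π i, L i) Λ) :
    IsFullLattice (Π i, L i) (Submodule.pi Set.univ (fun i => Subalgebra.toSubmodule (integralClosure ℤ (L i))) * Λ) :=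
  isFullLattice_mul isFullLattice_piIntegralSubmodule hΛ

omit [DecidableEq t] in
/-- **`N·(𝒪·Λ) ⊆ Λ` for some `N ≠ 0`**: a full lattice absorbs an integer multiple of the finitely generated `𝒪·Λ` — Shimura's
«`D(𝔪)` and `D(𝔪′)` are commensurable». [cite: Shimura1998, §6.2, proof of Thm. 3, p. 42] [cite: HertlingLarabi2026, §5 Lemma 5.2, chunk p0012] -/
theorem exists_smul_mem_of_mem_piIntegral_mul {Λ : Submodule ℤ (Π i, L i)} (hΛ : IsFullLattice (Π i, L i) Λ) :
    ∃ N : ℤ, N ≠ 0 ∧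
      ∀ x ∈ Submodule.pi Set.univ (fun i => Subalgebra.toSubmodule (integralClosure ℤ (L i))) * Λ, N • x ∈ Λ :=
  exists_smul_mem_of_fg hΛ (isFullLattice_piIntegral_mul hΛ).1

omit [∀ i, NumberField (L i)] [Fintype t] [DecidableEq t] in
/-- `𝒪·Λ` is `𝒪`-stable: `x ∈ 𝒪·Λ`, `a ∈ 𝒪` ⟹ `x·a ∈ 𝒪·Λ` (`Y` is commutative and `𝒪·𝒪 ⊆ 𝒪`).
[cite: HertlingLarabi2026, §5 Lemma 5.3 («`𝒪(L)·L = L`»), chunk p0012] -/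
theorem mul_mem_piIntegral_mul {Λ : Submodule ℤ (Π i, L i)} {x a : Π i, L i}
    (hx : x ∈ Submodule.pi Set.univ (fun i => Subalgebra.toSubmodule (integralClosure ℤ (L i))) * Λ)
    (ha : a ∈ Submodule.pi Set.univ (fun i => Subalgebra.toSubmodule (integralClosure ℤ (L i)))) :
    x * a ∈ Submodule.pi Set.univ (fun i => Subalgebra.toSubmodule (integralClosure ℤ (L i))) * Λ := by
  rw [show x * a = a * x from mul_comm x a]
  refine Submodule.mul_induction_on hx (fun o ho l hl => ?_) (fun y z hy hz => ?_)
  · rw [← mul_assoc]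
    exact Submodule.mul_mem_mul (mul_mem_piIntegralSubmodule ha ho) hl
  · rw [mul_add]
    exact Submodule.add_mem _ hy hz

omit [∀ i, NumberField (L i)] in
/-- **`𝒪·Λ = ⊕ᵢ (𝒪·Λ)^{(i)}`**: being stable under the idempotents `1_{Lᵢ} ∈ 𝒪`, `𝒪·Λ` is the product of its components.
[cite: HertlingLarabi2026, §6 Cor. 6.2 (b) («`L = ⊕_j L^{(j)}`»), chunk p0015] [cite: Shimura1998, §18.8 (proof, «`𝔞 = 𝔟_1 ⊕ ⋯ ⊕ 𝔟_t`»), p. 130] -/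
theorem piIntegral_mul_eq_pi_map_proj (Λ : Submodule ℤ (Π i, L i)) :
    Submodule.pi Set.univ (fun i => Subalgebra.toSubmodule (integralClosure ℤ (L i))) * Λ =
      Submodule.pi Set.univ (fun i =>
        (Submodule.pi Set.univ (fun i => Subalgebra.toSubmodule (integralClosure ℤ (L i))) * Λ).map
          (LinearMap.proj i : (Π i, L i) →ₗ[ℤ] L i)) :=
  eq_pi_map_proj_of_forall_mul_single_mem _ fun _ hm i =>
    mul_mem_piIntegral_mul hm (single_mem_piIntegralSubmodule i isIntegral_one)

/-- Each component `(𝒪·Λ)^{(i)} ⊂ Lᵢ` is a full `𝒪_{Lᵢ}`-stable lattice. [cite: HertlingLarabi2026, §6 Cor. 6.2 (b), chunk p0015] -/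
theorem isFullLattice_map_proj_piIntegral_mul {Λ : Submodule ℤ (Π i, L i)} (hΛ : IsFullLattice (Π i, L i) Λ) (i : t) :
    IsFullLattice (L i) ((Submodule.pi Set.univ (fun i => Subalgebra.toSubmodule (integralClosure ℤ (L i))) * Λ).map
        (LinearMap.proj i : (Π i, L i) →ₗ[ℤ] L i)) ∧
      ∀ m ∈ (Submodule.pi Set.univ (fun i => Subalgebra.toSubmodule (integralClosure ℤ (L i))) * Λ).map
          (LinearMap.proj i : (Π i, L i) →ₗ[ℤ] L i),
        ∀ a ∈ Subalgebra.toSubmodule (integralClosure ℤ (L i)),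
          m * a ∈ (Submodule.pi Set.univ (fun i => Subalgebra.toSubmodule (integralClosure ℤ (L i))) * Λ).map
            (LinearMap.proj i : (Π i, L i) →ₗ[ℤ] L i) := by
  refine ⟨isFullLattice_map_proj (isFullLattice_piIntegral_mul hΛ) i, fun m hm a ha => ?_⟩
  obtain ⟨m', hm', rfl⟩ := Submodule.mem_map.1 hm
  refine Submodule.mem_map.2 ⟨m' * Pi.single i a, mul_mem_piIntegral_mul hm'
    (single_mem_piIntegralSubmodule i ((mem_toSubmodule_integralClosure_iff (L i)).1 ha)), ?_⟩
  rw [LinearMap.proj_apply, LinearMap.proj_apply, Pi.mul_apply, Pi.single_eq_same]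

/-- **THE SANDWICH.**  For a full `ℤ`-lattice `Λ` of `Y = ∏ᵢ Lᵢ` there are NON-ZERO FRACTIONAL IDEALS `𝔞ᵢ` of the `𝒪_{Lᵢ}` and an
integer `N ≠ 0` with `Λ ⊆ ⊕ᵢ 𝔞ᵢ` and `N·(⊕ᵢ 𝔞ᵢ) ⊆ Λ`; indeed `⊕ᵢ 𝔞ᵢ = 𝒪·Λ`.  (Shimura's «commensurable» with the explicit partner
`𝒪𝔪`, a product of ideals as in the proof of §18.8.) [cite: Shimura1998, §6.2 proof of Thm. 3, p. 42; §18.8 (proof), p. 130]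
[cite: HertlingLarabi2026, §6 Thm. 6.1 (a)(b) and Cor. 6.2 (a)(b), chunk p0015] -/
theorem exists_fractionalIdeal_sandwich {Λ : Submodule ℤ (Π i, L i)} (hΛ : IsFullLattice (Π i, L i) Λ) :
    ∃ (𝔞 : ∀ i, FractionalIdeal (𝓞 (L i))⁰ (L i)) (N : ℤ), (∀ i, 𝔞 i ≠ 0) ∧ N ≠ 0 ∧
      Submodule.pi Set.univ (fun i => ((𝔞 i : Submodule (𝓞 (L i)) (L i)).restrictScalars ℤ)) =
        Submodule.pi Set.univ (fun i => Subalgebra.toSubmodule (integralClosure ℤ (L i))) * Λ ∧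
      Λ ≤ Submodule.pi Set.univ (fun i => ((𝔞 i : Submodule (𝓞 (L i)) (L i)).restrictScalars ℤ)) ∧
      ∀ x ∈ Submodule.pi Set.univ (fun i => ((𝔞 i : Submodule (𝓞 (L i)) (L i)).restrictScalars ℤ)), N • x ∈ Λ := by
  have hcomp := fun i => isFullLattice_map_proj_piIntegral_mul hΛ i
  choose 𝔞 h𝔞 h𝔞eq using fun i =>
    exists_fractionalIdeal_restrictScalars_eq_of_isFullLattice (hcomp i).1 (hcomp i).2
  obtain ⟨N, hN, hNΛ⟩ := exists_smul_mem_of_mem_piIntegral_mul hΛ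
  have hpi : Submodule.pi Set.univ (fun i => ((𝔞 i : Submodule (𝓞 (L i)) (L i)).restrictScalars ℤ)) =
      Submodule.pi Set.univ (fun i => Subalgebra.toSubmodule (integralClosure ℤ (L i))) * Λ := by
    rw [piIntegral_mul_eq_pi_map_proj Λ]
    exact congrArg (Submodule.pi Set.univ) (funext fun i => h𝔞eq i)
  refine ⟨𝔞, N, h𝔞, hN, hpi, ?_, fun x hx => hNΛ x ?_⟩
  · rw [hpi]
    exact le_piIntegral_mul Λ
  · rwa [hpi] at hx

end Product

/-! ## §3 R60-40: every torus with multiplication by `Y` is `Y`-isogenous to the maximal-order product -/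

namespace IsCMAlgTorusRat

variable {t : Type} {L : t → Type} [∀ i, Field (L i)] [∀ i, NumberField (L i)] [Fintype t] [DecidableEq t]
variable {ι : Type} [Fintype ι] [DecidableEq ι] {E : Type} [NormedAddCommGroup E] [NormedSpace ℂ E]
  {P : (ι → ℝ) ≃L[ℝ] E} {ρ : (Π i, L i) →ₐ[ℚ] Matrix ι ι ℚ}

/-- **Every complex torus with multiplication by the CM-algebra `Y = ∏ᵢ Lᵢ` of full degree — ANY lattice, ANY order — is
`Y`-EQUIVARIANTLY isogenous to the MAXIMAL-ORDER PRODUCT `∏ᵢ ℂ^{Φᵢ}/u(𝒪_{Lᵢ})`** (`Φᵢ` its CM types; `𝒪_{Lᵢ}` through Mathlib's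
`NumberField.integralBasis`, whose `ℤ`-span is `𝒪_{Lᵢ}`, `mem_span_integralBasis`): there is an integer matrix `T` with
`ρ(T) : ∏ᵢ ℂ^{Φᵢ}/u(𝒪_{Lᵢ}) → X` an isogeny and `T·diag(M_{aᵢ}) = ρ(a)·T` for all `a ∈ Y`.  The tree's
`exists_isIsogeny_sigmaPi_equivariant` («`A` is isogenous to `A_1 × ⋯ × A_t`», the Corollary of THEOREM 2 with its Remark on the
`F`-linearity of the isogeny) at the integral bases. [cite: Shimura1998, §6.1 Cor. of Thm. 2 and Remark, p. 41; §18.7–18.8, pp. 129–130] -/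
theorem exists_isIsogeny_sigmaPi_integralBasis_equivariant (h : IsCMAlgTorusRat P ρ) :
    ∃ T : Matrix ι (Σ i, Free.ChooseBasisIndex ℤ (𝓞 (L i))) ℤ,
      IsIsogeny (sigmaPiPeriod fun i => CMTorus.periodEquiv (h.cmType i) (NumberField.integralBasis (L i))) P T ∧
      ∀ a : Π i, L i, T.map (Int.cast : ℤ → ℚ) * CMTypeLattice.piLeftMulMatrix (fun i => NumberField.integralBasis (L i)) a =
        ρ a * T.map (Int.cast : ℤ → ℚ) :=
  h.exists_isIsogeny_sigmaPi_equivariant h.cmType (fun i => NumberField.integralBasis (L i)) (fun _ => rfl)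

end IsCMAlgTorusRat

end Literature.NumberTheory.ComplexMultiplication

end
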